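import Literature.Analysis.FluidPDE.PassiveScalarReleaseExistence
import Literature.Analysis.FluidPDE.PassiveScalarForcedClass

/-!
# Route TwoAndHalfD (AnomalousDissipation) — classical sourced passive scalars: `L²` balance,
# uniform `L²` bound, sourced weak formulation (support of item `ScalarLift2halfDR`,
# stmt-AnomalousDissipation-14983)

Helper file (everything proved): the classical half of the existence of weak SOURCED passive
scalars `∂ₜθ + u·∇θ = κΔθ + s` (`Literature.Analysis.FluidPDE.Torus.IsWeakScalarTransportForcedOn`)
by the regularisation scheme of DiPerna–Lions 1989, Prop. II.1 (the tree's
`PassiveScalarReleaseExistence` treats `s = 0`):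

* `forced_hasDerivWithinAt_scalarL2Sq` — the `L²` balance of a classical sourced solution,
  `d/dt‖θ‖² = -2κ‖∇θ‖² + 2∫θs` (DEIJ 2022, (1.2), with a source);
* `forced_scalarL2Sq_le` — for a steady smooth source and `κ ≥ 0`,
  `‖θ(t)‖² ≤ e^{T}(‖θ(0)‖² + ‖σ‖²)` on `[0, T]` (Grönwall through the monotonicity of
  `e^{-t}(‖θ(t)‖² + ‖σ‖²)`);
* `forced_isWeakScalarTransportForcedOn_of_classical` — classical sourced solutions on
  `S ⊇ [0, T]` are weak sourced solutions on `[0, T)` (sourced twin of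
  `IsClassicalScalarTransportOn.isWeakScalarTransportOn_holds`).

References: DiPerna–Lions 1989, Prop. II.1, §II.1; Drivas–Elgindi–Iyer–Jeong 2022, (1.1)–(1.2);
Evans 2010, §7.1.
-/

noncomputable section

open MeasureTheory Set Filter Topology Function UnitAddTorus
open scoped ENNReal NNReal InnerProductSpace
open Literature.Analysis.FunctionSpaces Literature.Analysis.FunctionSpaces.Torus
open Literature.Analysis.FluidPDE Literature.Analysis.FluidPDE.Torus

namespace Summit.AnomalousDissipation.AnomalousDissipation.Theorems

-- D-0017: single-problem summit ⇒ `Summit.AnomalousDissipation.AnomalousDissipation.…` by design.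
set_option linter.dupNamespace false

section Classical

variable {d : Type*} [Fintype d] [DecidableEq d]
variable {S : Set ℝ} {κ : ℝ} {u : ℝ → UnitAddTorus d → EuclideanSpace ℝ d} {s θ : ℝ → UnitAddTorus d → ℝ}

/-- **The `L²` balance of a classical sourced scalar**: on a convex time set,
`d/dt ‖θ(t)‖²_{L²} = -2κ‖∇θ(t)‖²_{L²} + 2∫ θ(t) s(t)` (multiply `∂ₜθ + u·∇θ = κΔθ + s` by `θ` and
integrate over `T^d`: the transport term vanishes by incompressibility, the viscous term is the
dissipation; DEIJ 2022, (1.2) with a source). [folklore] -/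
theorem forced_hasDerivWithinAt_scalarL2Sq (h : IsClassicalScalarTransportForcedOn S κ u s θ)
    (hS : Convex ℝ S) {t : ℝ} (ht : t ∈ S) :
    HasDerivWithinAt (fun τ => scalarL2Sq (θ τ))
      (-(2 * κ) * scalarGradNormSq (θ t) + 2 * ∫ x, θ t x * s t x) S t := by
  by_cases hacc : AccPt t (𝓟 S)
  swap
  · exact HasFDerivWithinAt.of_not_accPt hacc
  have hU : UniqueDiffOn ℝ S :=
    uniqueDiffOn_convex hS (interior_nonempty_of_convex_of_accPt hS ht hacc)
  have hθs := h.smooth_scalar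
  have hθt : IsSmooth (θ t) := hθs.isSmooth_slice ht
  have hut : IsSmooth (u t) := h.smooth_velocity.isSmooth_slice ht
  have hst : IsSmooth (s t) := h.smooth_source.isSmooth_slice ht
  -- differentiate `∫ θ²` under the integral sign
  have hφ : IsSmoothSpaceTimeOn S (fun τ x => θ τ x * θ τ x) := hθs.mul hθs
  have hE := hφ.hasDerivWithinAt_integral hS ht
  have htd : ∀ x, Torus.timeDerivWithin S (fun τ x => θ τ x * θ τ x) t x =
      2 * (θ t x * Torus.timeDerivWithin S θ t x) := by
    intro x
    have h2 : HasDerivWithinAt (fun τ => θ τ x * θ τ x)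
        (Torus.timeDerivWithin S θ t x * θ t x + θ t x * Torus.timeDerivWithin S θ t x) S t :=
      (hθs.hasDerivWithinAt_slice ht x).mul (hθs.hasDerivWithinAt_slice ht x)
    rw [Torus.timeDerivWithin, h2.derivWithin (hU t ht)]
    ring
  have hfun : (fun τ => scalarL2Sq (θ τ)) = fun τ => ∫ x, θ τ x * θ τ x := by
    funext τ
    simp only [scalarL2Sq, sq]
  rw [hfun]
  refine hE.congr_deriv ?_
  have hpt : (fun x => Torus.timeDerivWithin S (fun τ x => θ τ x * θ τ x) t x) =
      fun x => 2 * (κ * (θ t x * Torus.laplacian (θ t) x) -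
        θ t x * ⟪u t x, Torus.gradient (θ t) x⟫_ℝ + θ t x * s t x) := by
    funext x
    rw [htd x]
    have := h.transport t ht x
    have hre : Torus.timeDerivWithin S θ t x =
        κ * Torus.laplacian (θ t) x - ⟪u t x, Torus.gradient (θ t) x⟫_ℝ + s t x := by linarith
    rw [hre]
    ring
  have i1 : Integrable (fun x => θ t x * Torus.laplacian (θ t) x) volume := (hθt.smul' hθt.laplacian).integrable
  have i2 : Integrable (fun x => θ t x * ⟪u t x, Torus.gradient (θ t) x⟫_ℝ) volume :=
    (hθt.smul' (hut.inner hθt.gradient)).integrable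
  have i3 : Integrable (fun x => θ t x * s t x) volume := (hθt.smul' hst).integrable
  have i12 : Integrable (fun x => κ * (θ t x * Torus.laplacian (θ t) x) -
      θ t x * ⟪u t x, Torus.gradient (θ t) x⟫_ℝ) volume := (i1.const_mul κ).sub i2
  rw [hpt, integral_const_mul, integral_add i12 i3, integral_sub (i1.const_mul κ) i2, integral_const_mul,
    integral_mul_laplacian_self_eq_neg_scalarGradNormSq hθt,
    integral_mul_inner_gradient_self_eq_zero hut (h.divFree t ht) hθt]
  ring

/-- **Uniform `L²` bound for a classical scalar with a steady smooth source** on `[0, T]`, `κ ≥ 0`: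
`‖θ(t)‖²_{L²} ≤ e^{T} (‖θ(0)‖²_{L²} + ‖σ‖²_{L²})` (from the balance, `d/dt‖θ‖² ≤ 2∫θσ ≤ ‖θ‖² + ‖σ‖²`,
so `e^{-t}(‖θ(t)‖² + ‖σ‖²)` is non-increasing). [folklore] -/
theorem forced_scalarL2Sq_le {T : ℝ} (hT : 0 < T) {σ : UnitAddTorus d → ℝ}
    (h : IsClassicalScalarTransportForcedOn (Icc 0 T) κ u (fun _ => σ) θ) (hκ : 0 ≤ κ) {t : ℝ}
    (ht : t ∈ Icc 0 T) :
    scalarL2Sq (θ t) ≤ Real.exp T * (scalarL2Sq (θ 0) + scalarL2Sq σ) := by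
  have hconv : Convex ℝ (Icc (0 : ℝ) T) := convex_Icc 0 T
  have hσ : IsSmooth σ := h.smooth_source.isSmooth_slice (left_mem_Icc.2 hT.le)
  set E : ℝ → ℝ := fun τ => scalarL2Sq (θ τ) with hEdef
  set G : ℝ → ℝ := fun τ => Real.exp (-τ) * (E τ + scalarL2Sq σ) with hGdef
  -- the derivative bound `E' ≤ E + ‖σ‖²`
  have hder : ∀ τ ∈ Icc (0 : ℝ) T, HasDerivWithinAt E
      (-(2 * κ) * scalarGradNormSq (θ τ) + 2 * ∫ x, θ τ x * σ x) (Icc 0 T) τ := fun τ hτ =>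
    forced_hasDerivWithinAt_scalarL2Sq h hconv hτ
  have hbound : ∀ τ ∈ Icc (0 : ℝ) T,
      -(2 * κ) * scalarGradNormSq (θ τ) + 2 * ∫ x, θ τ x * σ x ≤ E τ + scalarL2Sq σ := by
    intro τ hτ
    have hθτ : IsSmooth (θ τ) := h.smooth_scalar.isSmooth_slice hτ
    have h1 : 0 ≤ scalarGradNormSq (θ τ) := integral_nonneg fun x => sq_nonneg _
    have h2 : 2 * ∫ x, θ τ x * σ x ≤ E τ + scalarL2Sq σ := by
      have i1 : Integrable (fun x => θ τ x ^ 2) volume := (hθτ.continuous.pow 2).integrable_unitAddTorus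
      have i2 : Integrable (fun x => σ x ^ 2) volume := (hσ.continuous.pow 2).integrable_unitAddTorus
      have i3 : Integrable (fun x => 2 * (θ τ x * σ x)) volume :=
        ((hθτ.continuous.mul hσ.continuous).integrable_unitAddTorus).const_mul 2
      simp only [hEdef, scalarL2Sq]
      rw [← integral_const_mul, ← integral_add i1 i2]
      exact integral_mono i3 (i1.add i2) fun x => by nlinarith [sq_nonneg (θ τ x - σ x)]
    nlinarith
  -- `G` is non-increasing on `[0, T]`
  have hEc : ContinuousOn E (Icc 0 T) := fun τ hτ => (hder τ hτ).continuousWithinAt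
  have hGc : ContinuousOn G (Icc 0 T) :=
    (Real.continuous_exp.comp continuous_neg).continuousOn.mul (hEc.add continuousOn_const)
  have hGanti : AntitoneOn G (Icc 0 T) := by
    have hG' : ∀ τ ∈ Ioo (0 : ℝ) T, HasDerivAt G
        (Real.exp (-τ) * -1 * (E τ + scalarL2Sq σ) +
          Real.exp (-τ) * (-(2 * κ) * scalarGradNormSq (θ τ) + 2 * ∫ x, θ τ x * σ x)) τ := by
      intro τ hτ
      have hd := ((hder τ (Ioo_subset_Icc_self hτ)).hasDerivAt (Icc_mem_nhds hτ.1 hτ.2))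
      have h1 : HasDerivAt (fun τ : ℝ => Real.exp (-τ)) (Real.exp (-τ) * -1) τ :=
        (Real.hasDerivAt_exp (-τ)).comp τ (hasDerivAt_neg τ)
      exact h1.mul (hd.add_const (scalarL2Sq σ))
    refine antitoneOn_of_deriv_nonpos hconv hGc (fun τ hτ => ?_) fun τ hτ => ?_
    · rw [interior_Icc] at hτ
      exact (hG' τ hτ).differentiableAt.differentiableWithinAt
    · rw [interior_Icc] at hτ
      rw [(hG' τ hτ).deriv]
      have hb := hbound τ (Ioo_subset_Icc_self hτ)
      have hexp : 0 < Real.exp (-τ) := Real.exp_pos _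
      nlinarith
  -- conclusion
  have hG0 := hGanti (left_mem_Icc.2 hT.le) ht ht.1
  simp only [hGdef, neg_zero, Real.exp_zero, one_mul] at hG0
  have hexp : 0 < Real.exp (-t) := Real.exp_pos _
  have hexp' : Real.exp t ≤ Real.exp T := Real.exp_le_exp.2 ht.2
  have hpos : 0 ≤ scalarL2Sq (θ 0) + scalarL2Sq σ :=
    add_nonneg (integral_nonneg fun x => sq_nonneg _) (integral_nonneg fun x => sq_nonneg _)
  have hσ0 : 0 ≤ scalarL2Sq σ := integral_nonneg fun x => sq_nonneg _
  have h1 : E t + scalarL2Sq σ ≤ Real.exp t * (scalarL2Sq (θ 0) + scalarL2Sq σ) := by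
    have := mul_le_mul_of_nonneg_left hG0 (Real.exp_pos t).le
    rw [← mul_assoc, ← Real.exp_add, add_neg_cancel, Real.exp_zero, one_mul] at this
    exact this
  calc scalarL2Sq (θ t) = E t := rfl
    _ ≤ Real.exp t * (scalarL2Sq (θ 0) + scalarL2Sq σ) := by linarith
    _ ≤ Real.exp T * (scalarL2Sq (θ 0) + scalarL2Sq σ) := mul_le_mul_of_nonneg_right hexp' hpos

/-- **Classical sourced scalars are weak sourced scalars**: a classical solution of
`∂ₜθ + u·∇θ = κΔθ + s` on a time set `S ⊇ [0, T]` is a weak solution on `T^d × [0, T)` with datum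
`θ 0` and source `s` (multiply by a test function, integrate by parts on `T^d` and in time; the
integrability clauses hold by continuity on the compact `[0,T] × T^d`). Sourced twin of the tree's
`IsClassicalScalarTransportOn.isWeakScalarTransportOn_holds`. [folklore] -/
theorem forced_isWeakScalarTransportForcedOn_of_classical {T : ℝ}
    (h : IsClassicalScalarTransportForcedOn S κ u s θ) (hS : Icc 0 T ⊆ S) :
    IsWeakScalarTransportForcedOn T κ u s (θ 0) θ := by
  have hu : IsSmoothSpaceTimeOn S u := h.smooth_velocity
  have hθ : IsSmoothSpaceTimeOn S θ := h.smooth_scalar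
  have hs : IsSmoothSpaceTimeOn S s := h.smooth_source
  have hIoo_S : Ioo 0 T ⊆ S := Ioo_subset_Icc_self.trans hS
  obtain ⟨Cθ, hCθ⟩ := hθ.exists_norm_le_of_isCompact isCompact_Icc hS
  obtain ⟨Cu, hCu⟩ := hu.exists_norm_le_of_isCompact isCompact_Icc hS
  obtain ⟨Cs, hCs⟩ := hs.exists_norm_le_of_isCompact isCompact_Icc hS
  have hbθ : ∀ t ∈ Ioo 0 T, ∀ x, ‖θ t x‖ₑ ≤ (Cθ.toNNReal : ℝ≥0∞) := fun t ht x => by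
    rw [← ofReal_norm]
    exact ENNReal.ofReal_le_ofReal (hCθ t (Ioo_subset_Icc_self ht) x)
  have hbu : ∀ t ∈ Ioo 0 T, ∀ x, ‖u t x‖ₑ ≤ (Cu.toNNReal : ℝ≥0∞) := fun t ht x => by
    rw [← ofReal_norm]
    exact ENNReal.ofReal_le_ofReal (hCu t (Ioo_subset_Icc_self ht) x)
  have hbs : ∀ t ∈ Ioo 0 T, ∀ x, ‖s t x‖ₑ ≤ (Cs.toNNReal : ℝ≥0∞) := fun t ht x => by
    rw [← ofReal_norm]
    exact ENNReal.ofReal_le_ofReal (hCs t (Ioo_subset_Icc_self ht) x)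
  have hvol : volume (Ioo (0 : ℝ) T) < ⊤ := by
    rw [Real.volume_Ioo]; exact ENNReal.ofReal_lt_top
  have hu2 : ∀ t ∈ Ioo 0 T, ∫⁻ x, ‖u t x‖ₑ ^ 2 ≤ (Cu.toNNReal : ℝ≥0∞) ^ 2 := fun t ht =>
    calc ∫⁻ x, ‖u t x‖ₑ ^ 2 ≤ ∫⁻ _, (Cu.toNNReal : ℝ≥0∞) ^ 2 :=
          lintegral_mono fun x => by gcongr; exact hbu t ht x
      _ = (Cu.toNNReal : ℝ≥0∞) ^ 2 := by rw [lintegral_const, measure_univ, mul_one]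
  refine ⟨?_, ?_, ?_, ?_, ?_, ?_, ?_, ?_, ?_⟩
  · exact hθ.aestronglyMeasurable_stLift measurableSet_Ioo hIoo_S
  · exact hu.aestronglyMeasurable_stLift measurableSet_Ioo hIoo_S
  · exact hs.aestronglyMeasurable_stLift measurableSet_Ioo hIoo_S
  · refine ⟨Cθ.toNNReal ^ 2, (ae_restrict_iff' measurableSet_Ioo).2 (ae_of_all _ fun t ht => ?_)⟩
    calc ∫⁻ x, ‖θ t x‖ₑ ^ 2 ≤ ∫⁻ _, (Cθ.toNNReal : ℝ≥0∞) ^ 2 :=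
          lintegral_mono fun x => by gcongr; exact hbθ t ht x
      _ = ((Cθ.toNNReal ^ 2 : ℝ≥0) : ℝ≥0∞) := by
          rw [lintegral_const, measure_univ, mul_one, ENNReal.coe_pow]
  · calc ∫⁻ t in Ioo 0 T, (∫⁻ x, ‖u t x‖ₑ ^ 2) ^ (1 / 2 : ℝ)
        ≤ ∫⁻ _ in Ioo 0 T, ((Cu.toNNReal : ℝ≥0∞) ^ 2) ^ (1 / 2 : ℝ) :=
          setLIntegral_mono' measurableSet_Ioo fun t ht => ENNReal.rpow_le_rpow (hu2 t ht) (by norm_num)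
      _ = ((Cu.toNNReal : ℝ≥0∞) ^ 2) ^ (1 / 2 : ℝ) * volume (Ioo (0 : ℝ) T) := setLIntegral_const _ _
      _ < ⊤ := ENNReal.mul_lt_top (ENNReal.rpow_lt_top_of_nonneg (by norm_num)
          (ENNReal.pow_ne_top ENNReal.coe_ne_top)) hvol
  · calc ∫⁻ t in Ioo 0 T, ∫⁻ x, ‖u t x‖ₑ * ‖θ t x‖ₑ
        ≤ ∫⁻ _ in Ioo 0 T, (Cu.toNNReal : ℝ≥0∞) * Cθ.toNNReal :=
          setLIntegral_mono' measurableSet_Ioo fun t ht =>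
            calc ∫⁻ x, ‖u t x‖ₑ * ‖θ t x‖ₑ ≤ ∫⁻ _, (Cu.toNNReal : ℝ≥0∞) * Cθ.toNNReal :=
                  lintegral_mono fun x => mul_le_mul' (hbu t ht x) (hbθ t ht x)
              _ = (Cu.toNNReal : ℝ≥0∞) * Cθ.toNNReal := by rw [lintegral_const, measure_univ, mul_one]
      _ = (Cu.toNNReal : ℝ≥0∞) * Cθ.toNNReal * volume (Ioo (0 : ℝ) T) := setLIntegral_const _ _
      _ < ⊤ := ENNReal.mul_lt_top (ENNReal.mul_lt_top ENNReal.coe_lt_top ENNReal.coe_lt_top) hvol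
  · calc ∫⁻ t in Ioo 0 T, ∫⁻ x, ‖s t x‖ₑ ≤ ∫⁻ _ in Ioo 0 T, (Cs.toNNReal : ℝ≥0∞) :=
          setLIntegral_mono' measurableSet_Ioo fun t ht =>
            calc ∫⁻ x, ‖s t x‖ₑ ≤ ∫⁻ _, (Cs.toNNReal : ℝ≥0∞) := lintegral_mono fun x => hbs t ht x
              _ = (Cs.toNNReal : ℝ≥0∞) := by rw [lintegral_const, measure_univ, mul_one]
      _ = (Cs.toNNReal : ℝ≥0∞) * volume (Ioo (0 : ℝ) T) := setLIntegral_const _ _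
      _ < ⊤ := ENNReal.mul_lt_top ENNReal.coe_lt_top hvol
  · refine (ae_restrict_iff' measurableSet_Ioo).2 (ae_of_all _ fun t ht => ?_)
    exact (h.divFree t (hIoo_S ht)).isWeaklyDivFree_holds (hu.isSmooth_slice (hIoo_S ht))
  · intro ψ hψ
    obtain ⟨hψs, T', hT'T, hT'⟩ := id hψ
    rcases le_or_gt T 0 with hT | hT
    · rw [Ioo_eq_empty (not_lt.2 hT), Measure.restrict_empty, integral_zero_measure, integral_zero_measure,
        hT' 0 (hT'T.le.trans hT)]
      simp
    set I : Set ℝ := Icc 0 T with hI_def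
    have hIS : I ⊆ S := hS
    have hU : UniqueDiffOn ℝ I := uniqueDiffOn_Icc hT
    have hθI : IsSmoothSpaceTimeOn I θ := hθ.mono hIS
    have hsI : IsSmoothSpaceTimeOn I s := hs.mono hIS
    have hψI : IsSmoothSpaceTimeOn I ψ := hψs.contDiffOn
    have hg : IsSmoothSpaceTimeOn I (fun t x => θ t x * ψ t x) := hθI.mul hψI
    have hsψ : IsSmoothSpaceTimeOn I (fun t x => s t x * ψ t x) := hsI.mul hψI
    set E : ℝ → ℝ := fun t => ∫ x, θ t x * ψ t x with hE_def
    set E' : ℝ → ℝ := fun t => ∫ x, Torus.timeDerivWithin I (fun t x => θ t x * ψ t x) t x with hE'_def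
    have hE : ∀ t ∈ I, HasDerivWithinAt E (E' t) I t := fun t ht => hg.hasDerivWithinAt_integral (convex_Icc 0 T) ht
    have hE'cont : ContinuousOn E' I := hg.continuousOn_integral_timeDerivWithin hU
    have hSrc : ContinuousOn (fun t => ∫ x, s t x * ψ t x) I := hsψ.continuousOn_integral (convex_Icc 0 T)
    have hET : E T = 0 := by
      simp only [hE_def, hT' T hT'T.le, Pi.zero_apply, mul_zero, integral_zero]
    have hFTC : ∫ t in Ioo 0 T, E' t = E T - E 0 := by
      rw [← integral_Ioc_eq_integral_Ioo, ← intervalIntegral.integral_of_le hT.le,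
        intervalIntegral.integral_eq_sub_of_hasDerivAt_of_le hT.le
          (fun t ht => (hE t ht).continuousWithinAt)
          (fun t ht => (hE t (Ioo_subset_Icc_self ht)).hasDerivAt (Icc_mem_nhds ht.1 ht.2))
          ((hE'cont.mono (uIcc_of_le hT.le).subset).intervalIntegrable)]
    -- the integrand is `E' - ∫ s ψ` on `(0, T)`
    have hkey : ∀ t ∈ Ioo 0 T, (∫ x, θ t x *
        (Torus.timeDeriv ψ t x + ⟪u t x, Torus.gradient (ψ t) x⟫_ℝ + κ * Torus.laplacian (ψ t) x)) +
        ∫ x, s t x * ψ t x = E' t := by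
      intro t ht
      have htS : t ∈ S := hIoo_S ht
      have htI : t ∈ I := Ioo_subset_Icc_self ht
      have hut : IsSmooth (u t) := hu.isSmooth_slice htS
      have hθt : IsSmooth (θ t) := hθ.isSmooth_slice htS
      have hst : IsSmooth (s t) := hs.isSmooth_slice htS
      have hψt : IsSmooth (ψ t) := hψI.isSmooth_slice htI
      have hψ't : IsSmooth (Torus.timeDeriv ψ t) := hψ.timeDeriv.isSmooth_slice t
      have hI_nhds : I ∈ 𝓝 t := Icc_mem_nhds ht.1 ht.2
      have hS_nhds : S ∈ 𝓝 t := mem_of_superset hI_nhds hIS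
      have hAeq : ∀ x, Torus.timeDerivWithin I θ t x = Torus.timeDerivWithin S θ t x := fun x => by
        rw [Torus.timeDerivWithin, Torus.timeDerivWithin, derivWithin_of_mem_nhds hI_nhds,
          derivWithin_of_mem_nhds hS_nhds]
      have h3 : ∀ x, Torus.timeDerivWithin S θ t x =
          κ * Torus.laplacian (θ t) x - ⟪u t x, Torus.gradient (θ t) x⟫_ℝ + s t x := fun x => by
        have := h.transport t htS x
        linarith
      have hslice : ∀ x, Torus.timeDerivWithin I (fun t x => θ t x * ψ t x) t x =
          (κ * Torus.laplacian (θ t) x - ⟪u t x, Torus.gradient (θ t) x⟫_ℝ + s t x) * ψ t x +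
            θ t x * Torus.timeDeriv ψ t x := by
        intro x
        have h1 : HasDerivWithinAt (fun τ => θ τ x) (Torus.timeDerivWithin S θ t x) I t := by
          have h' := hθI.hasDerivWithinAt_slice htI x
          rwa [hAeq x] at h'
        have h2 : HasDerivWithinAt (fun τ => ψ τ x) (Torus.timeDeriv ψ t x) I t := by
          obtain ⟨y, rfl⟩ := proj_surjective x
          have hd : Differentiable ℝ (fun τ : ℝ => stLift ψ (τ, y)) :=
            (hψs.differentiable (by simp)).comp (differentiable_id.prodMk (differentiable_const y))
          exact (hd t).hasDerivAt.hasDerivWithinAt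
        have h12 := (h1.fun_mul h2).derivWithin (hU t htI)
        rw [Torus.timeDerivWithin, h12, h3]
      have iA : Integrable (fun x => θ t x * Torus.timeDeriv ψ t x) volume := (hθt.smul' hψ't).integrable
      have iB : Integrable (fun x => θ t x * ⟪u t x, Torus.gradient (ψ t) x⟫_ℝ) volume :=
        (hθt.smul' (hut.inner hψt.gradient)).integrable
      have iB' : Integrable (fun x => ⟪u t x, Torus.gradient (θ t) x⟫_ℝ * ψ t x) volume :=
        ((hut.inner hθt.gradient).smul' hψt).integrable
      have iC : Integrable (fun x => κ * (θ t x * Torus.laplacian (ψ t) x)) volume :=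
        (hθt.smul' hψt.laplacian).integrable.const_mul κ
      have iC' : Integrable (fun x => κ * (Torus.laplacian (θ t) x * ψ t x)) volume :=
        (hθt.laplacian.smul' hψt).integrable.const_mul κ
      have iS : Integrable (fun x => s t x * ψ t x) volume := (hst.smul' hψt).integrable
      have iAB : Integrable (fun x => θ t x * Torus.timeDeriv ψ t x + θ t x * ⟪u t x, Torus.gradient (ψ t) x⟫_ℝ) volume :=
        iA.add iB
      have iC'B' : Integrable (fun x => κ * (Torus.laplacian (θ t) x * ψ t x) -
          ⟪u t x, Torus.gradient (θ t) x⟫_ℝ * ψ t x) volume := iC'.sub iB'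
      have iC'B'S : Integrable (fun x => κ * (Torus.laplacian (θ t) x * ψ t x) -
          ⟪u t x, Torus.gradient (θ t) x⟫_ℝ * ψ t x + s t x * ψ t x) volume := iC'B'.add iS
      have hB := integral_mul_inner_gradient_add_eq_zero hut (h.divFree t htS) hθt hψt
      have hC : ∫ x, κ * (θ t x * Torus.laplacian (ψ t) x) = ∫ x, κ * (Torus.laplacian (θ t) x * ψ t x) := by
        rw [integral_const_mul, integral_const_mul, integral_mul_laplacian_comm_holds hθt hψt]
      have hL : (fun x => θ t x *
          (Torus.timeDeriv ψ t x + ⟪u t x, Torus.gradient (ψ t) x⟫_ℝ + κ * Torus.laplacian (ψ t) x)) =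
          fun x => θ t x * Torus.timeDeriv ψ t x + θ t x * ⟪u t x, Torus.gradient (ψ t) x⟫_ℝ +
            κ * (θ t x * Torus.laplacian (ψ t) x) := funext fun x => by ring
      have hR : (fun x => Torus.timeDerivWithin I (fun t x => θ t x * ψ t x) t x) =
          fun x => κ * (Torus.laplacian (θ t) x * ψ t x) - ⟪u t x, Torus.gradient (θ t) x⟫_ℝ * ψ t x +
            s t x * ψ t x + θ t x * Torus.timeDeriv ψ t x := funext fun x => by rw [hslice x]; ring
      simp only [hE'_def]
      rw [hL, hR, integral_add iAB iC, integral_add iA iB, integral_add iC'B'S iA, integral_add iC'B' iS,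
        integral_sub iC' iB', hC]
      linarith
    -- integrate in time and split the source
    have hIntE : IntegrableOn E' (Ioo 0 T) :=
      (hE'cont.integrableOn_compact isCompact_Icc).mono_set Ioo_subset_Icc_self
    have hIntS : IntegrableOn (fun t => ∫ x, s t x * ψ t x) (Ioo 0 T) :=
      (hSrc.integrableOn_compact isCompact_Icc).mono_set Ioo_subset_Icc_self
    have h1 : ∫ t in Ioo 0 T, ∫ x, θ t x *
        (Torus.timeDeriv ψ t x + ⟪u t x, Torus.gradient (ψ t) x⟫_ℝ + κ * Torus.laplacian (ψ t) x) =
        ∫ t in Ioo 0 T, (E' t - ∫ x, s t x * ψ t x) :=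
      setIntegral_congr_fun measurableSet_Ioo fun t ht => by
        have := hkey t ht
        linarith
    have h2 : ∫ t in Ioo 0 T, (E' t - ∫ x, s t x * ψ t x) = (∫ t in Ioo 0 T, E' t) - ∫ t in Ioo 0 T, ∫ x, s t x * ψ t x :=
      integral_sub hIntE hIntS
    rw [h1, h2, hFTC, hET, zero_sub, hE_def]
    ring

end Classical

end Summit.AnomalousDissipation.AnomalousDissipation.Theorems

end
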